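import Summits.SmoothPoincare4.SmoothPoincare4.Theorems.SymplecticOrigamiOrigamiFoldExistenceStubOuterCleanRecognitionChartRay

/-!
# Stub `stub_outerCleanRecognitionChart` of line `shadow-pleats` for crux `OrigamiFoldExistence` — E:
# the OUTER COLLAR of the fold: thin-collar injectivity, one-sidedness, local surjectivity (item stmt-SmoothPoincare4-7844, route SymplecticOrigami; seat c3, S4''-chart worker)

Fifth helper file towards `stub_outerCleanRecognitionChart : OuterCleanRecognitionChart`, over
file D (`…ChartRay`: in the straightened coordinates of a good shell `h : StrShell D` the lifted
chart shadow `λ ∘ G` maps each radial segment into one tube fibre, with fibre height profile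
`rayT x r`, `rayT x 2 = 0`, and — for `G` immersive on the open outer collar — an OUTER SIGN
`s = ±1` making `s · rayT x` strictly increasing on `[2, 2 + κ)` and `s · tubeT > 0` on the open
outer collar).  Consequences = the first-order structure of the fold collar that the sheet
count and the construction of `Φ` consume (no Whitney normal form, no second derivatives):

* **`injOn_outerCollar`** (registered helper) — `G` is INJECTIVE ON THE THIN CLOSED COLLAR
  `{2 ≤ ‖u‖ < 2 + κ}` (equal shadows have equal tube coordinates; equal core points put the
  straightened points on one ray; on a ray the height profile is injective); so is `λ ∘ G`;
* `liftS4_apply_mem_tube_side` — the open outer collar is mapped INTO ONE SIDE of the crease in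
  the tube: `λ (G u) = τ (tubeW u, tubeT u • e₀)` with `0 < s · tubeT u`;
* `exists_height_localSurj` — LOCAL SURJECTIVITY onto that side: there is `t₀ > 0` such that
  every tube point `τ (x, t • e₀)` with `0 ≤ s t ≤ t₀` is the lifted shadow of a collar point
  `u`, `2 ≤ ‖u‖ ≤ 2 + κ/2` (intermediate values of the increasing profiles, `t₀` a uniform lower
  bound of `s · rayT x (2 + κ/2)` over the compact `S³`);
* `exists_strShell_abs_tubeT_le` — good shells on which the fibre height stays `≤ 1/4` in
  absolute value (where the tree's side function IS the fibre coordinate, `sideσ_tube`).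

Sources: M. W. Hirsch, *Differential Topology* (1976), Ch. 4 §5–§6; the lead's
`OuterClean-analysis-c3.md` §2 (A4) and §3 (O2).
-/

noncomputable section

-- the prescribed namespace `Summit.<P>.<Sub>.…` duplicates `SmoothPoincare4` (P = Sub)
set_option linter.dupNamespace false

open scoped Manifold ContDiff Topology RealInnerProductSpace
open Set Function Filter Metric
open Literature.Topology.FourManifolds Literature.Topology.FourManifolds.SphereHypersurfaceSides

namespace Summit.SmoothPoincare4.SmoothPoincare4.Theorems.OrigamiFoldExistence.ShadowPleats

section Collar

variable {G : EuclideanSpace ℝ (Fin 4) → EuclideanSpace ℝ (Fin 4)} {D : TubeData (liftS4 ∘ radialSphere G 2)}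

namespace StrShell

variable (h : StrShell D)

/-- **GOOD SHELLS WITH SMALL FIBRE HEIGHT**: shrinking a good shell, the fibre height stays
`≤ 1/4` in absolute value on it (it is continuous and vanishes on `S(0,2)`). -/
theorem exists_strShell_abs_tubeT_le (hG : ContDiff ℝ ∞ G) :
    ∃ h' : StrShell D, h'.κ ≤ h.κ ∧ ∀ u ∈ foldShell h'.κ, |tubeT D u| ≤ 1 / 4 := by
  set O : Set (EuclideanSpace ℝ (Fin 4)) := tubeDom D ∩ (tubeT D) ⁻¹' Ioo (-(1 / 4)) (1 / 4) with hO
  have hOopen : IsOpen O :=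
    (contDiffOn_tubeT D hG).continuousOn.isOpen_inter_preimage (isOpen_tubeDom D hG.continuous) isOpen_Ioo
  have hS : Metric.sphere (0 : EuclideanSpace ℝ (Fin 4)) 2 ⊆ O := fun u hu => by
    have hu2 := mem_sphere_zero_iff_norm.1 hu
    refine ⟨mem_tubeDom_of_norm D hu2, ?_⟩
    show tubeT D u ∈ Ioo (-(1 / 4)) (1 / 4)
    rw [tubeT_of_norm D hu2]
    constructor <;> norm_num
  obtain ⟨κ₁, hκ₁, -, hsub⟩ := exists_foldShell_subset hOopen hS
  refine ⟨h.shrink (lt_min hκ₁ h.pos) (min_le_right _ _), min_le_right _ _, fun u hu => ?_⟩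
  have hu' : u ∈ foldShell κ₁ := foldShell_mono (min_le_left _ _) hu
  have := (hsub hu').2
  rw [abs_le]
  exact ⟨this.1.le, this.2.le⟩

variable {s : ℝ}

/-- **THIN-COLLAR INJECTIVITY**: `G` is injective on the closed outer collar
`{2 ≤ ‖u‖ < 2 + κ}` of a good shell carrying an outer sign. [folklore] -/
theorem injOn_outerCollar_of_sign (hG : ContDiff ℝ ∞ G)
    (himm : ∀ u : EuclideanSpace ℝ (Fin 4), 2 < ‖u‖ → ‖u‖ < 2 + h.κ → Injective (fderiv ℝ G u))
    (hs : s = 1 ∨ s = -1)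
    (hsign : ∀ u : EuclideanSpace ℝ (Fin 4), 2 < ‖u‖ → ‖u‖ < 2 + h.κ → 0 < s * tubeT D u) :
    InjOn G {u | 2 ≤ ‖u‖ ∧ ‖u‖ < 2 + h.κ} := by
  intro u₁ hu₁ u₂ hu₂ heq
  have hκ := h.pos
  have hm₁ : u₁ ∈ foldShell h.κ := ⟨by linarith [hu₁.1], hu₁.2⟩
  have hm₂ : u₂ ∈ foldShell h.κ := ⟨by linarith [hu₂.1], hu₂.2⟩
  obtain ⟨hW, hT⟩ := tubeW_eq_of_apply_eq D heq
  obtain ⟨x₁, hx₁, hinv₁, hT₁⟩ := h.exists_eq_strInv_smul hm₁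
  obtain ⟨x₂, hx₂, hinv₂, hT₂⟩ := h.exists_eq_strInv_smul hm₂
  -- equal core points: the two straightened points lie on one ray
  have hx : x₁ = x₂ := by
    have e₁ : (x₁ : EuclideanSpace ℝ (Fin 4)) = tubeV D u₁ := by
      have := congrArg (fun w => ‖u₁‖⁻¹ • w) hx₁
      simp only [smul_smul, inv_mul_cancel₀ (norm_ne_zero_iff.2 (h.ne_zero hm₁)), one_smul] at this
      rw [this, ← tubeV_eq_smul_str D (h.ne_zero hm₁)]
    have e₂ : (x₂ : EuclideanSpace ℝ (Fin 4)) = tubeV D u₂ := by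
      have := congrArg (fun w => ‖u₂‖⁻¹ • w) hx₂
      simp only [smul_smul, inv_mul_cancel₀ (norm_ne_zero_iff.2 (h.ne_zero hm₂)), one_smul] at this
      rw [this, ← tubeV_eq_smul_str D (h.ne_zero hm₂)]
    apply Subtype.ext
    rw [e₁, e₂, tubeV, tubeV, hW]
  subst hx
  -- equal heights: equal radii, by injectivity of the increasing profile
  have hr : ‖u₁‖ = ‖u₂‖ := by
    have hmono := h.strictMonoOn_sign_mul_rayT hG himm hs hsign x₁
    apply hmono.injOn ⟨hu₁.1, hu₁.2⟩ ⟨hu₂.1, hu₂.2⟩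
    show s * rayT D h.κ x₁ ‖u₁‖ = s * rayT D h.κ x₁ ‖u₂‖
    rw [← hT₁, ← hT₂, hT]
  rw [← hinv₁, ← hinv₂, hr]

/-- The lifted shadow is injective on the closed outer collar as well. -/
theorem injOn_liftS4_outerCollar_of_sign (hG : ContDiff ℝ ∞ G)
    (himm : ∀ u : EuclideanSpace ℝ (Fin 4), 2 < ‖u‖ → ‖u‖ < 2 + h.κ → Injective (fderiv ℝ G u))
    (hs : s = 1 ∨ s = -1)
    (hsign : ∀ u : EuclideanSpace ℝ (Fin 4), 2 < ‖u‖ → ‖u‖ < 2 + h.κ → 0 < s * tubeT D u) :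
    InjOn (fun u => liftS4 (G u)) {u | 2 ≤ ‖u‖ ∧ ‖u‖ < 2 + h.κ} := fun _ hu₁ _ hu₂ heq =>
  h.injOn_outerCollar_of_sign hG himm hs hsign hu₁ hu₂ (liftS4_injective heq)

/-- **ONE-SIDEDNESS**: the open outer collar is mapped into the `s`-side of the tube,
`λ (G u) = τ (tubeW u, tubeT u • e₀)` with `0 < s · tubeT u`. -/
theorem liftS4_apply_mem_tube_side
    (hsign : ∀ u : EuclideanSpace ℝ (Fin 4), 2 < ‖u‖ → ‖u‖ < 2 + h.κ → 0 < s * tubeT D u)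
    {u : EuclideanSpace ℝ (Fin 4)} (hu2 : 2 < ‖u‖) (huκ : ‖u‖ < 2 + h.κ) :
    liftS4 (G u) = D.τ (tubeW D u, tubeT D u • SphereHypersurfaceSides.e₀) ∧ 0 < s * tubeT D u :=
  ⟨(τ_tubeW_tubeT D (h.subset_tubeDom ⟨by linarith [h.pos], huκ⟩)).symm, hsign u hu2 huκ⟩

/-- The profile at the test radius `2 + κ/2` depends continuously on the direction. -/
theorem continuous_rayT_testRadius (hG : ContDiff ℝ ∞ G) :
    Continuous fun x : Metric.sphere (0 : EuclideanSpace ℝ (Fin 4)) 1 => rayT D h.κ x (2 + h.κ / 2) := by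
  have hκ := h.pos
  have hmem : ∀ x : Metric.sphere (0 : EuclideanSpace ℝ (Fin 4)) 1,
      (2 + h.κ / 2) • (x : EuclideanSpace ℝ (Fin 4)) ∈ foldShell h.κ := fun x =>
    h.smul_mem_foldShell x (by linarith) (by linarith)
  have h1 : Continuous fun x : Metric.sphere (0 : EuclideanSpace ℝ (Fin 4)) 1 =>
      (2 + h.κ / 2) • (x : EuclideanSpace ℝ (Fin 4)) :=
    (continuous_const (y := 2 + h.κ / 2)).smul continuous_subtype_val
  have h2 : Continuous fun x : Metric.sphere (0 : EuclideanSpace ℝ (Fin 4)) 1 =>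
      strInv D h.κ ((2 + h.κ / 2) • (x : EuclideanSpace ℝ (Fin 4))) :=
    (h.contDiffOn_strInv hG).continuousOn.comp_continuous h1 hmem
  exact (contDiffOn_tubeT D hG).continuousOn.comp_continuous h2 fun x => h.subset_tubeDom (h.strInv_mem (hmem x))

/-- **LOCAL SURJECTIVITY onto the side**: there is `t₀ > 0` such that every tube point
`τ (x, t • e₀)` with `0 ≤ s t ≤ t₀` is the lifted shadow of a point `u` of the collar
`{2 ≤ ‖u‖ ≤ 2 + κ/2}` (intermediate value theorem along the increasing profiles; `t₀` is a
uniform lower bound of `s · rayT x (2 + κ/2)` over the compact sphere of directions).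
[folklore] -/
theorem exists_height_localSurj (hG : ContDiff ℝ ∞ G)
    (himm : ∀ u : EuclideanSpace ℝ (Fin 4), 2 < ‖u‖ → ‖u‖ < 2 + h.κ → Injective (fderiv ℝ G u))
    (hs : s = 1 ∨ s = -1)
    (hsign : ∀ u : EuclideanSpace ℝ (Fin 4), 2 < ‖u‖ → ‖u‖ < 2 + h.κ → 0 < s * tubeT D u) :
    ∃ t₀ : ℝ, 0 < t₀ ∧ ∀ (x : Metric.sphere (0 : EuclideanSpace ℝ (Fin 4)) 1) (t : ℝ), 0 ≤ s * t → s * t ≤ t₀ →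
      ∃ u : EuclideanSpace ℝ (Fin 4), 2 ≤ ‖u‖ ∧ ‖u‖ ≤ 2 + h.κ / 2 ∧
        liftS4 (G u) = D.τ (x, t • SphereHypersurfaceSides.e₀) := by
  have hκ := h.pos
  set r₁ : ℝ := 2 + h.κ / 2 with hr₁
  have hr₁2 : 2 < r₁ := by rw [hr₁]; linarith
  have hr₁κ : r₁ < 2 + h.κ := by rw [hr₁]; linarith
  -- the uniform lower bound `t₀`
  set g : Metric.sphere (0 : EuclideanSpace ℝ (Fin 4)) 1 → ℝ := fun x => s * rayT D h.κ x r₁ with hg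
  have hgcont : Continuous g := continuous_const.mul (h.continuous_rayT_testRadius hG)
  have hgpos : ∀ x, 0 < g x := fun x => by
    have hmono := h.strictMonoOn_sign_mul_rayT hG himm hs hsign x
    have := hmono ⟨le_rfl, by linarith⟩ ⟨hr₁2.le, hr₁κ⟩ hr₁2
    simpa only [hg, h.rayT_two, mul_zero] using this
  obtain ⟨x₀, -, hx₀⟩ := isCompact_univ.exists_isMinOn univ_nonempty hgcont.continuousOn
  refine ⟨g x₀, hgpos x₀, fun x t ht0 ht1 => ?_⟩
  -- intermediate value along the profile of `x` on `[2, r₁]`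
  have hcont : ContinuousOn (fun r => s * rayT D h.κ x r) (Icc 2 r₁) :=
    (continuousOn_const.mul (h.continuousOn_rayT hG x)).mono fun r hr => ⟨by linarith [hr.1], by linarith [hr.2]⟩
  have hle : s * t ≤ s * rayT D h.κ x r₁ := ht1.trans (hx₀ (mem_univ x))
  have h0 : s * rayT D h.κ x 2 = 0 := by rw [h.rayT_two, mul_zero]
  obtain ⟨r, hr, hrt⟩ := intermediate_value_Icc hr₁2.le hcont ⟨by rw [h0]; exact ht0, hle⟩
  have hrt' : rayT D h.κ x r = t := by
    rcases hs with rfl | rfl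
    · simpa using hrt
    · have : -1 * rayT D h.κ x r = -1 * t := hrt
      linarith
  refine ⟨strInv D h.κ (r • (x : EuclideanSpace ℝ (Fin 4))), ?_, ?_, ?_⟩
  · rw [h.norm_strInv (h.smul_mem_foldShell x (by linarith [hr.1]) (by linarith [hr.2])),
      norm_smul_sphere (by linarith [hr.1]) x]
    exact hr.1
  · rw [h.norm_strInv (h.smul_mem_foldShell x (by linarith [hr.1]) (by linarith [hr.2])),
      norm_smul_sphere (by linarith [hr.1]) x]
    exact hr.2
  · rw [h.liftS4_apply_strInv_smul x (by linarith [hr.1]) (by linarith [hr.2]), hrt']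

end StrShell

/-! ### The registered helper: thin-collar injectivity of the chart shadow -/

/-- **THIN-COLLAR INJECTIVITY OF A CHART SHADOW** (registered helper of file E).  Let
`G : ℝ⁴ → ℝ⁴` be smooth, injective on the outer fold sphere `S(0,2)` with transverse fold
kernels there (so that the lifted crease is a smooth embedding and has tube data `D`), and
immersive on an open outer collar `{2 < ‖u‖ < 2 + η}`.  Then `G` is injective on a thin
CLOSED outer collar `{2 ≤ ‖u‖ < 2 + κ}`, `κ > 0`. [folklore] -/
theorem injOn_outerCollar (D : TubeData (liftS4 ∘ radialSphere G 2)) (hG : ContDiff ℝ ∞ G) {η : ℝ} (hη : 0 < η)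
    (himm : ∀ u : EuclideanSpace ℝ (Fin 4), 2 < ‖u‖ → ‖u‖ < 2 + η → Injective (fderiv ℝ G u)) :
    ∃ κ : ℝ, 0 < κ ∧ InjOn G {u | 2 ≤ ‖u‖ ∧ ‖u‖ < 2 + κ} := by
  obtain ⟨h₀⟩ := nonempty_strShell D hG
  set h := h₀.shrink (lt_min hη h₀.pos) (min_le_right _ _) with hh
  have himm' : ∀ u : EuclideanSpace ℝ (Fin 4), 2 < ‖u‖ → ‖u‖ < 2 + h.κ → Injective (fderiv ℝ G u) :=
    fun u hu1 hu2 => himm u hu1 (by linarith [min_le_left η h₀.κ, show h.κ = min η h₀.κ from rfl])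
  obtain ⟨s, hs, hsign⟩ := h.exists_outerSign hG himm'
  exact ⟨h.κ, h.pos, h.injOn_outerCollar_of_sign hG himm' hs hsign⟩

end Collar

end Summit.SmoothPoincare4.SmoothPoincare4.Theorems.OrigamiFoldExistence.ShadowPleats

end
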